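import Mathlib
import Summits.ValiantsHypothesis.ValiantsHypothesis.Theorems.LacunarySymmetroidMatrixDescartesDetLorentzianHessianDefinite
import HarnessLib

/-!
# ValiantsHypothesis / LacunarySymmetroid — crux `MatrixDescartes` (stmt-ValiantsHypothesis-18050, V1),
# line `Cruxes/MatrixDescartes/Lines/lorentzian_shadow.lean`: `IsLorentzianArray m K (detArray m K A)` for ALL
# positive DEFINITE tuples, all `m, K` — the definite case of the KNOWN stub `stub_detLorentzian`

Assembly only (`0` named facts, no definitions): the four conjuncts of the line's
`IsLorentzianArray m K (detArray m K A)` — (a) nonnegative coefficients and (b) support in the layer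
(`DetLorentzian.detArray_nonneg_of_posSemidef`, `detArray_eq_zero_of_not_mem_layer`, val-lit-p7), (c) M-convex support,
for definite tuples the whole layer (`DetLorentzianDefinite.isLorentzianArray_parts_abc_of_posDef`), and (d) the Hessian
signature (`DetLorentzianHessianDefinite.atMostOnePosEig_hessAt_detArray_of_posDef`, val-lit-p6, by Gårding–Rolle through the
definite cone on top of `DetLorentzianHessianPderiv` / `DetLorentzianHyperbolicQuadratic`) — conjoined into
**`isLorentzianArray_detArray_of_posDef`**, stated with `detArray / layer / exch / IsMConvexOn / factWeight / hessAt /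
AtMostOnePosEig` UNFOLDED exactly as in the line file (not importable from `Theorems/`), so that
`example (hA : ∀ l, (A l).PosDef) : IsLorentzianArray m K (detArray m K A) := isLorentzianArray_detArray_of_posDef m K A hA`
elaborates by `exact` against verbatim copies of the line's definitions (checked in scratch).

Honest framing: this is "PSD determinantal pencils are Lorentzian" (Brändén–Huh / Gårding) for DEFINITE tuples; the
positive SEMIdefinite case of (d) (limit `A_l + εI`, val-lit-p5) completes `stub_detLorentzian`; the line's LAW stub
`stub_lorentzianDescartes`, the crux `MatrixDescartes`, Conjecture B and `VP ≠ VNP` stay OPEN / NOT proved; no ledger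
item closes (helper of an unregistered alternative line).
-/

-- `Summit.ValiantsHypothesis.ValiantsHypothesis.…` is the tree's mandated single-conjunct layout (Sub = Summit).
set_option linter.dupNamespace false

noncomputable section

namespace Summit.ValiantsHypothesis.ValiantsHypothesis.Theorems.LacunarySymmetroidMatrixDescartes

open Matrix Finset
open scoped BigOperators

namespace DetLorentzianDefiniteLorentzian

/-- **`stub_detLorentzian` for ALL positive DEFINITE tuples, all `m, K`**: the four conjuncts of the line's
`IsLorentzianArray m K (detArray m K A)` (UNFOLDED; the line closes it by `exact`) for `A_l ≻ 0` —
(a)(b) `DetLorentzian.*` (val-lit-p7), (c) `DetLorentzianDefinite.isLorentzianArray_parts_abc_of_posDef`,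
(d) `atMostOnePosEig_hessAt_detArray_of_posDef`.  The PSD case is the `ε ↓ 0` limit of `A_l + εI` (sibling file).
[folklore] -/
theorem isLorentzianArray_detArray_of_posDef (m K : ℕ) (A : Fin K → Matrix (Fin m) (Fin m) ℝ)
    (hA : ∀ l, (A l).PosDef) :
    (∀ α : Fin K → ℕ, 0 ≤ MvPolynomial.coeff (Finsupp.equivFunOnFinite.symm α)
      (Matrix.det (∑ l, (MvPolynomial.X l : MvPolynomial (Fin K) ℝ) • (A l).map MvPolynomial.C))) ∧
    (∀ α : Fin K → ℕ,
      α ∉ (Fintype.piFinset fun _ : Fin K => Finset.range (m + 1)).filter (fun α => ∑ i, α i = m) →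
      MvPolynomial.coeff (Finsupp.equivFunOnFinite.symm α)
        (Matrix.det (∑ l, (MvPolynomial.X l : MvPolynomial (Fin K) ℝ) • (A l).map MvPolynomial.C)) = 0) ∧
    (∀ α ∈ ((Fintype.piFinset fun _ : Fin K => Finset.range (m + 1)).filter (fun α => ∑ i, α i = m)).filter
        (fun α => MvPolynomial.coeff (Finsupp.equivFunOnFinite.symm α)
          (Matrix.det (∑ l, (MvPolynomial.X l : MvPolynomial (Fin K) ℝ) • (A l).map MvPolynomial.C)) ≠ 0),
      ∀ β ∈ ((Fintype.piFinset fun _ : Fin K => Finset.range (m + 1)).filter (fun α => ∑ i, α i = m)).filter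
        (fun α => MvPolynomial.coeff (Finsupp.equivFunOnFinite.symm α)
          (Matrix.det (∑ l, (MvPolynomial.X l : MvPolynomial (Fin K) ℝ) • (A l).map MvPolynomial.C)) ≠ 0),
      ∀ i : Fin K, β i < α i →
        ∃ j : Fin K, α j < β j ∧
          (α - Pi.single i 1 + Pi.single j 1) ∈
            ((Fintype.piFinset fun _ : Fin K => Finset.range (m + 1)).filter (fun α => ∑ i, α i = m)).filter
              (fun α => MvPolynomial.coeff (Finsupp.equivFunOnFinite.symm α)
                (Matrix.det (∑ l, (MvPolynomial.X l : MvPolynomial (Fin K) ℝ) • (A l).map MvPolynomial.C)) ≠ 0) ∧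
          (β - Pi.single j 1 + Pi.single i 1) ∈
            ((Fintype.piFinset fun _ : Fin K => Finset.range (m + 1)).filter (fun α => ∑ i, α i = m)).filter
              (fun α => MvPolynomial.coeff (Finsupp.equivFunOnFinite.symm α)
                (Matrix.det (∑ l, (MvPolynomial.X l : MvPolynomial (Fin K) ℝ) • (A l).map MvPolynomial.C)) ≠ 0) ∧
          (0 : ℚ) + 0 ≤ 0 + 0) ∧
    (∀ γ ∈ (Fintype.piFinset fun _ : Fin K => Finset.range (m - 2 + 1)).filter (fun α => ∑ i, α i = m - 2),
      ∀ v w : Fin K → ℝ,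
        0 < v ⬝ᵥ ((fun i j : Fin K =>
              ((∏ k, ((γ + Pi.single i 1 + Pi.single j 1 : Fin K → ℕ) k).factorial : ℕ) : ℝ) *
                MvPolynomial.coeff (Finsupp.equivFunOnFinite.symm (γ + Pi.single i 1 + Pi.single j 1))
                  (Matrix.det (∑ l, (MvPolynomial.X l : MvPolynomial (Fin K) ℝ) • (A l).map MvPolynomial.C)))
            *ᵥ v) →
          (v ⬝ᵥ ((fun i j : Fin K =>
              ((∏ k, ((γ + Pi.single i 1 + Pi.single j 1 : Fin K → ℕ) k).factorial : ℕ) : ℝ) *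
                MvPolynomial.coeff (Finsupp.equivFunOnFinite.symm (γ + Pi.single i 1 + Pi.single j 1))
                  (Matrix.det (∑ l, (MvPolynomial.X l : MvPolynomial (Fin K) ℝ) • (A l).map MvPolynomial.C)))
            *ᵥ v)) *
            (w ⬝ᵥ ((fun i j : Fin K =>
              ((∏ k, ((γ + Pi.single i 1 + Pi.single j 1 : Fin K → ℕ) k).factorial : ℕ) : ℝ) *
                MvPolynomial.coeff (Finsupp.equivFunOnFinite.symm (γ + Pi.single i 1 + Pi.single j 1))
                  (Matrix.det (∑ l, (MvPolynomial.X l : MvPolynomial (Fin K) ℝ) • (A l).map MvPolynomial.C)))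
            *ᵥ w)) ≤
          (v ⬝ᵥ ((fun i j : Fin K =>
              ((∏ k, ((γ + Pi.single i 1 + Pi.single j 1 : Fin K → ℕ) k).factorial : ℕ) : ℝ) *
                MvPolynomial.coeff (Finsupp.equivFunOnFinite.symm (γ + Pi.single i 1 + Pi.single j 1))
                  (Matrix.det (∑ l, (MvPolynomial.X l : MvPolynomial (Fin K) ℝ) • (A l).map MvPolynomial.C)))
            *ᵥ w)) ^ 2) := by
  obtain ⟨ha, hb, hc⟩ := DetLorentzianDefinite.isLorentzianArray_parts_abc_of_posDef m K A hA
  exact ⟨ha, hb, hc, DetLorentzianHessianDefinite.atMostOnePosEig_hessAt_detArray_of_posDef m K A hA⟩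


end DetLorentzianDefiniteLorentzian

end Summit.ValiantsHypothesis.ValiantsHypothesis.Theorems.LacunarySymmetroidMatrixDescartes

end
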